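import Summits.Parity.GeneralizedHardyLittlewood.Theorems.PrimeLevelFamEdgeMomentsBeyondDiagonalDiagDecorCross
import Summits.Parity.GeneralizedHardyLittlewood.Theorems.PrimeLevelFamEdgeMomentsBeyondDiagonalDiagDecorPrimeSqSq
import HarnessLib

/-!
# Route `PrimeLevelFamEdge`, crux K_A `MomentsBeyondDiagonal` (stmt-Parity-20007), line «petersson_layers» v4, stub `stub_diag`:
# **the `P₂³`-decorated coprime Selberg sum: `Σ_{k≤y,(k,n)=1}τ(k)W(k)P₂(k)³logᶜ(y/k) = −176·(c!/(c+4)!)·E_n·log^{c+4}y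
# + O(D(n)(1+κ(n))(1+log y)^{c+3})`** (`c ≥ 2`) — the cubic family of `M₆ = τ(15P₂³ − 30P₂P₄ + 16P₆)`

Peeling one prime of `P₂³ = (P₂·P₂)·Σ_p log²p` (`…DiagDecorPrime.sum_copTauW_mul_mul_sum_primeFactors_eq`, weight `G·P₂²`) and
splitting `P₂(pk′) = log²p + P₂(k′)` on the support of `a_{np}(k′)`:
`Σ aG·P₂³ = P₆-peel + 2·Σ_p log⁴p·a_n(p)Σ a_{np}G(pk′)P₂(k′) + Σ_p log²p·a_n(p)Σ a_{np}G(pk′)P₂(k′)²`; the three pieces are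
`−240`, `+2·24`, `+16` in units `c!/(c+4)!·E_n log^{c+4}y` (`…DecorPrimePowTwo … 5`; `…DiagDecorCross.abs_decorCross_sub_le`
over the `P₂`-engine with `m = 3` and over the `P₂²`-engine `…DiagDecorPrimeSqSq` with `m = 1`):

* `copTauW_mul_primeSq_prime_mul_sq` — `a_{np}(k′)·P₂(pk′)² = a_{np}(k′)·(log²p + P₂(k′))²`;
* `sum_copTauW_mul_primeSq_cube_eq` — the displayed three-piece decomposition;
* `p2cube_factorial_identity` — `240 − 48 − 16 = 176`;
* `abs_coprimeSumPow_primeSqCube_add_le` — **the displayed asymptotic**.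

Def-free; theorems only. Helper `--supports stmt-Parity-20007`; closes nothing; K_A, K_B and the Parity summit are NOT proved;
nothing about Landau–Siegel zeros.

## References
* E. Kowalski, P. Michel, J. VanderKam, J. reine angew. Math. 526 (2000), (23)–(28) pp. 13–15 and Prop. 5.1 p. 18.
  [cite: KowalskiMichelVanderKam2000, (23)–(28) — derivation (prime-power-log decorations of the Selberg coordinates)]
-/

noncomputable section

open scoped Real
open Finset ArithmeticFunction

namespace Summit.Parity.GeneralizedHardyLittlewood.Theorems.MomentsBeyondDiagonal.DiagKernel

open Literature.NumberTheory.LFunctions Literature.NumberTheory.LFunctions.KMV2000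
open SelbergCoord (kappa)
open Summit.Parity.GeneralizedHardyLittlewood.Theorems.BeyondDiagonalBeatsQuarter.KernelFormXSq
  (copTauW mainConst divWeight divWeight_nonneg mainConst_nonneg)
open Summit.Parity.GeneralizedHardyLittlewood.Theorems.MomentsBeyondDiagonal.DiagLines
  (sum_copTauW_mul_mul_sum_primeFactors_eq copTauW_mul_primePowSum_prime_mul)

/-- `a_{np}(k)·P₂(pk)² = a_{np}(k)·(log²p + P₂(k))²` for a prime `p` (both sides vanish when `p ∣ k`). [folklore] -/
theorem copTauW_mul_primeSq_prime_mul_sq {p : ℕ} (hp : p.Prime) (n k : ℕ) :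
    copTauW (n * p) k * ((∑ q ∈ (p * k).primeFactors, Real.log q ^ 2) * ∑ q ∈ (p * k).primeFactors, Real.log q ^ 2) =
      copTauW (n * p) k * ((Real.log p ^ 2 + ∑ q ∈ k.primeFactors, Real.log q ^ 2) *
        (Real.log p ^ 2 + ∑ q ∈ k.primeFactors, Real.log q ^ 2)) := by
  have h := copTauW_mul_primePowSum_prime_mul hp n k 2
  calc copTauW (n * p) k * ((∑ q ∈ (p * k).primeFactors, Real.log q ^ 2) * ∑ q ∈ (p * k).primeFactors, Real.log q ^ 2)
      = (copTauW (n * p) k * ∑ q ∈ (p * k).primeFactors, Real.log q ^ 2) *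
          ∑ q ∈ (p * k).primeFactors, Real.log q ^ 2 := by ring
    _ = (∑ q ∈ (p * k).primeFactors, Real.log q ^ 2 : ℝ) • (Real.log p ^ 2 + ∑ q ∈ k.primeFactors, Real.log q ^ 2) *
          copTauW (n * p) k := by rw [h, smul_eq_mul]; ring
    _ = (Real.log p ^ 2 + ∑ q ∈ k.primeFactors, Real.log q ^ 2) *
          (copTauW (n * p) k * ∑ q ∈ (p * k).primeFactors, Real.log q ^ 2) := by rw [smul_eq_mul]; ring
    _ = _ := by rw [h]; ring

/-- **Three-piece decomposition of the `P₂³`-decoration** (any `n, N`, weight `G`):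
`Σ_k a_n(k)G(k)P₂(k)³ = Σ_p log⁶p·a(p)Σ a_{np}G(pk′) + 2Σ_p log⁴p·a(p)Σ a_{np}G(pk′)P₂(k′) + Σ_p log²p·a(p)Σ a_{np}G(pk′)P₂(k′)²`.
[cite: KowalskiMichelVanderKam2000, (23)–(28) — derivation (prime decorations → prime sums)] -/
theorem sum_copTauW_mul_primeSq_cube_eq (n N : ℕ) (G : ℕ → ℝ) :
    ∑ k ∈ Icc 1 N, copTauW n k * G k * (∑ q ∈ k.primeFactors, Real.log q ^ 2) ^ 3 =
      ∑ p ∈ (Icc 1 N).filter Nat.Prime, Real.log p ^ 6 * copTauW n p *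
          ∑ k ∈ Icc 1 (N / p), copTauW (n * p) k * G (p * k) +
        2 * ∑ p ∈ (Icc 1 N).filter Nat.Prime, Real.log p ^ 4 * copTauW n p *
          ∑ k ∈ Icc 1 (N / p), copTauW (n * p) k * (G (p * k) * ∑ q ∈ k.primeFactors, Real.log q ^ 2) +
        ∑ p ∈ (Icc 1 N).filter Nat.Prime, Real.log p ^ 2 * copTauW n p *
          ∑ k ∈ Icc 1 (N / p), copTauW (n * p) k * (G (p * k) * (∑ q ∈ k.primeFactors, Real.log q ^ 2) ^ 2) := by
  have h := sum_copTauW_mul_mul_sum_primeFactors_eq n N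
    (fun k ↦ G k * ((∑ q ∈ k.primeFactors, Real.log q ^ 2) * ∑ q ∈ k.primeFactors, Real.log q ^ 2))
    (fun p ↦ Real.log p ^ 2)
  have hl : ∑ k ∈ Icc 1 N, copTauW n k * G k * (∑ q ∈ k.primeFactors, Real.log q ^ 2) ^ 3 =
      ∑ k ∈ Icc 1 N, copTauW n k *
        (G k * ((∑ q ∈ k.primeFactors, Real.log q ^ 2) * ∑ q ∈ k.primeFactors, Real.log q ^ 2)) *
        ∑ p ∈ k.primeFactors, Real.log p ^ 2 :=
    Finset.sum_congr rfl fun k _ ↦ by ring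
  rw [hl, h, Finset.mul_sum, ← Finset.sum_add_distrib, ← Finset.sum_add_distrib]
  refine Finset.sum_congr rfl fun p hp ↦ ?_
  have hp' : p.Prime := (Finset.mem_filter.1 hp).2
  rw [mul_assoc (Real.log p ^ 6), mul_assoc (Real.log p ^ 4) (copTauW n p), mul_assoc (Real.log p ^ 2) (copTauW n p),
    mul_assoc (Real.log p ^ 2) (copTauW n p),
    Finset.mul_sum, Finset.mul_sum, Finset.mul_sum, Finset.mul_sum, Finset.mul_sum, Finset.mul_sum, Finset.mul_sum,
    Finset.mul_sum, Finset.mul_sum, ← Finset.sum_add_distrib, ← Finset.sum_add_distrib]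
  refine Finset.sum_congr rfl fun k _ ↦ ?_
  have hsq := copTauW_mul_primeSq_prime_mul_sq hp' n k
  calc Real.log p ^ 2 * (copTauW n p * (copTauW (n * p) k *
        (G (p * k) * ((∑ q ∈ (p * k).primeFactors, Real.log q ^ 2) * ∑ q ∈ (p * k).primeFactors, Real.log q ^ 2))))
      = Real.log p ^ 2 * (copTauW n p * G (p * k)) *
          (copTauW (n * p) k * ((∑ q ∈ (p * k).primeFactors, Real.log q ^ 2) *
            ∑ q ∈ (p * k).primeFactors, Real.log q ^ 2)) := by ring
    _ = Real.log p ^ 2 * (copTauW n p * G (p * k)) *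
          (copTauW (n * p) k * ((Real.log p ^ 2 + ∑ q ∈ k.primeFactors, Real.log q ^ 2) *
            (Real.log p ^ 2 + ∑ q ∈ k.primeFactors, Real.log q ^ 2))) := by rw [hsq]
    _ = Real.log p ^ 6 * (copTauW n p * (copTauW (n * p) k * G (p * k))) +
          2 * (Real.log p ^ 4 * (copTauW n p * (copTauW (n * p) k * (G (p * k) * ∑ q ∈ k.primeFactors, Real.log q ^ 2)))) +
          Real.log p ^ 2 * (copTauW n p * (copTauW (n * p) k *
            (G (p * k) * (∑ q ∈ k.primeFactors, Real.log q ^ 2) ^ 2))) := by ring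

/-- The coefficient bookkeeping of the `P₂³` family (`240 − 2·24 − 16 = 176` in units `c!/(c+4)!`): for `c ≥ 2`,
`2c(c−1)·(5!(c−2)!/(c+4)!) − 2·(2·2·(3!c!/(c+4)!)) − 2·(8(c!/(c+2)!))·(1!(c+2)!/(c+4)!) = 176·c!/(c+4)!`. [folklore] -/
theorem p2cube_factorial_identity {c : ℕ} (hc : 2 ≤ c) :
    2 * ((c : ℝ) * ((c : ℝ) - 1)) * (((Nat.factorial 5 : ℕ) : ℝ) * (c - 2).factorial / (c + 4).factorial) -
        2 * (2 * 2 * (((Nat.factorial 3 : ℕ) : ℝ) * c.factorial / (c + 4).factorial)) -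
        2 * (8 * ((c.factorial : ℝ) / (c + 2).factorial)) *
          (((Nat.factorial 1 : ℕ) : ℝ) * (c + 2).factorial / (c + 4).factorial) =
      176 * ((c.factorial : ℝ) / (c + 4).factorial) := by
  obtain ⟨j, rfl⟩ : ∃ j, c = j + 2 := ⟨c - 2, by omega⟩
  have e1 : j + 2 - 2 = j := by omega
  rw [e1]
  have h2 : ((j + 2).factorial : ℝ) = ((j : ℝ) + 2) * ((j : ℝ) + 1) * j.factorial := by
    have : (j + 2).factorial = (j + 2) * ((j + 1) * j.factorial) := by
      rw [show j + 2 = (j + 1) + 1 by omega, Nat.factorial_succ, Nat.factorial_succ]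
    rw [this]; push_cast; ring
  have hF2 : ((j + 2 + 2).factorial : ℝ) ≠ 0 := by exact_mod_cast Nat.factorial_ne_zero _
  have hF4 : ((j + 2 + 4).factorial : ℝ) ≠ 0 := by exact_mod_cast Nat.factorial_ne_zero _
  have hj : (j.factorial : ℝ) ≠ 0 := by exact_mod_cast Nat.factorial_ne_zero _
  rw [h2, show Nat.factorial 5 = 120 from rfl, show Nat.factorial 3 = 6 from rfl, show Nat.factorial 1 = 1 from rfl]
  push_cast
  field_simp
  ring

/-- **The `P₂³`-decorated coprime Selberg sum** (`c ≥ 2`): there is `C` with, for all `n ≥ 1`, `y ≥ 1`,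
`|Σ_{k≤y} a_n(k)·logᶜ(y/k)·P₂(k)³ + 176·(c!/(c+4)!)·E_n·log^{c+4}y| ≤ C·D(n)(1+κ(n))(1+log y)^{c+3}`.
[cite: KowalskiMichelVanderKam2000, (23)–(28) — derivation] -/
theorem abs_coprimeSumPow_primeSqCube_add_le {c : ℕ} (hc : 2 ≤ c) :
    ∃ C : ℝ, 0 < C ∧ ∀ n : ℕ, n ≠ 0 → ∀ y : ℝ, 1 ≤ y →
      |∑ k ∈ Icc 1 ⌊y⌋₊, copTauW n k * Real.log (y / k) ^ c * (∑ p ∈ k.primeFactors, Real.log p ^ 2) ^ 3 +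
          176 * ((c.factorial : ℝ) / (c + 4).factorial) * mainConst n * Real.log y ^ (c + 4)| ≤
        C * divWeight n * (1 + kappa n) * (1 + Real.log y) ^ (c + 3) := by
  obtain ⟨C₆, hC₆, h₆⟩ := abs_coprimeSumPow_primePow_add_le_of_two_le 5 hc
  obtain ⟨C₂, hC₂, h₂⟩ := abs_coprimeSumPow_primeSq_add_le_of_two_le hc
  obtain ⟨C₂₂, hC₂₂, h₂₂⟩ := abs_coprimeSumPow_primeSqSq_add_le hc
  -- the `P₂`-engine in the `A·E·log^{e+1}` shape (`e = c − 1`)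
  have h₂' : ∀ n : ℕ, n ≠ 0 → ∀ y : ℝ, 1 ≤ y →
      |∑ k ∈ Icc 1 ⌊y⌋₊, copTauW n k * Real.log (y / k) ^ c * (fun k : ℕ ↦ ∑ p ∈ k.primeFactors, Real.log p ^ 2) k +
          2 * mainConst n * Real.log y ^ (c - 1 + 1)| ≤
        C₂ * divWeight n * (1 + kappa n) * (1 + Real.log y) ^ (c - 1) := by
    intro n hn y hy
    rw [Nat.sub_add_cancel (by omega : 1 ≤ c)]
    exact h₂ n hn y hy
  obtain ⟨C_A, hC_A, hA⟩ := abs_decorCross_sub_le (fun k : ℕ ↦ ∑ p ∈ k.primeFactors, Real.log p ^ 2) 3 (c - 1) hC₂ h₂'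
  obtain ⟨C_B, hC_B, hB⟩ := abs_decorCross_sub_le (fun k : ℕ ↦ (∑ p ∈ k.primeFactors, Real.log p ^ 2) ^ 2) 1 (c + 1)
    hC₂₂ h₂₂
  refine ⟨C₆ + 2 * C_A + C_B, by positivity, fun n hn y hy ↦ ?_⟩
  set N := ⌊y⌋₊ with hN
  have hP6 := h₆ n hn y hy
  have hAn := hA n hn y hy
  have hBn := hB n hn y hy
  beta_reduce at hAn hBn
  have e56 : c - 2 + 5 = c + 3 := by omega
  rw [show ((5 : ℕ) + 1) = 6 from rfl, e56] at hP6
  have e6 : c + 3 + 1 = c + 4 := by omega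
  rw [e6] at hP6
  have ea1 : c - 1 + 1 = c := by omega
  have ea2 : c + 3 + 1 = c + 4 := by omega
  rw [show ((3 : ℕ) + 1) = 4 from rfl, ea1, show c + 1 + 3 = c + 3 + 1 by ring, ea2] at hAn
  rw [show ((1 : ℕ) + 1) = 2 from rfl, show c + 1 + 1 + 1 + 1 = c + 4 by ring, show c + 1 + 1 + 1 = c + 3 by ring,
    show c + 1 + 1 = c + 2 by ring] at hBn
  -- decomposition
  have hpeel6 := sum_copTauW_mul_mul_sum_primeFactors_eq n N (fun k : ℕ ↦ Real.log (y / k) ^ c)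
    (fun p : ℕ ↦ Real.log p ^ 6)
  have hcube := sum_copTauW_mul_primeSq_cube_eq n N (fun k : ℕ ↦ Real.log (y / k) ^ c)
  beta_reduce at hpeel6 hcube
  rw [← hpeel6] at hcube
  rw [hcube]
  have hid := p2cube_factorial_identity hc
  have key : ∀ {P X Y M₁ M₂ M₃ M : ℝ}, M₁ - 2 * M₂ - M₃ = M →
      P + 2 * X + Y + M = (P + M₁) + 2 * (X - M₂) + (Y - M₃) := by
    intro P X Y M₁ M₂ M₃ M h; rw [← h]; ring
  rw [key (M₁ := 2 * ((c : ℝ) * ((c : ℝ) - 1)) * (((Nat.factorial 5 : ℕ) : ℝ) * (c - 2).factorial / (c + 4).factorial) *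
      mainConst n * Real.log y ^ (c + 4))
    (M₂ := 2 * 2 * (((Nat.factorial 3 : ℕ) : ℝ) * c.factorial / (c + 4).factorial) * mainConst n * Real.log y ^ (c + 4))
    (M₃ := 2 * (8 * ((c.factorial : ℝ) / (c + 2).factorial)) *
      (((Nat.factorial 1 : ℕ) : ℝ) * (c + 2).factorial / (c + 4).factorial) * mainConst n * Real.log y ^ (c + 4))
    (by rw [← hid]; ring)]
  calc _ ≤ |∑ k ∈ Icc 1 N, copTauW n k * Real.log (y / k) ^ c * ∑ p ∈ k.primeFactors, Real.log p ^ 6 +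
          2 * ((c : ℝ) * ((c : ℝ) - 1)) * (((Nat.factorial 5 : ℕ) : ℝ) * (c - 2).factorial / (c + 4).factorial) *
            mainConst n * Real.log y ^ (c + 4)| +
        |2 * (∑ p ∈ (Icc 1 N).filter Nat.Prime, Real.log p ^ 4 * copTauW n p *
          ∑ k ∈ Icc 1 (N / p), copTauW (n * p) k *
            (Real.log (y / ((p * k : ℕ) : ℝ)) ^ c * ∑ q ∈ k.primeFactors, Real.log q ^ 2) -
          2 * 2 * (((Nat.factorial 3 : ℕ) : ℝ) * c.factorial / (c + 4).factorial) * mainConst n * Real.log y ^ (c + 4))| +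
        |∑ p ∈ (Icc 1 N).filter Nat.Prime, Real.log p ^ 2 * copTauW n p *
          ∑ k ∈ Icc 1 (N / p), copTauW (n * p) k *
            (Real.log (y / ((p * k : ℕ) : ℝ)) ^ c * (∑ q ∈ k.primeFactors, Real.log q ^ 2) ^ 2) -
          2 * (8 * ((c.factorial : ℝ) / (c + 2).factorial)) *
            (((Nat.factorial 1 : ℕ) : ℝ) * (c + 2).factorial / (c + 4).factorial) * mainConst n * Real.log y ^ (c + 4)| :=
        (abs_add_le _ _).trans (add_le_add (abs_add_le _ _) le_rfl)
    _ ≤ C₆ * divWeight n * (1 + kappa n) * (1 + Real.log y) ^ (c + 3) +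
        2 * (C_A * divWeight n * (1 + kappa n) * (1 + Real.log y) ^ (c + 3)) +
        C_B * divWeight n * (1 + kappa n) * (1 + Real.log y) ^ (c + 3) := by
        refine add_le_add (add_le_add hP6 ?_) hBn
        rw [abs_mul, abs_of_pos (by norm_num : (0 : ℝ) < 2)]
        exact mul_le_mul_of_nonneg_left hAn (by norm_num)
    _ = (C₆ + 2 * C_A + C_B) * divWeight n * (1 + kappa n) * (1 + Real.log y) ^ (c + 3) := by ring

end Summit.Parity.GeneralizedHardyLittlewood.Theorems.MomentsBeyondDiagonal.DiagKernel

end
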